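import Summits.QuantumFields.YangMills.Theorems.BalabanUVNodesPortZDHistoryFluctuation
import Literature.MathematicalPhysics.QuantumFieldTheory.Balaban1983to89.Node00.Record13

/-!
# NODE O port, row PT-A′ helper lane (PTZ-1, gen 3): THE TRANSPORTS OF RECORD ARE DEGREE-ONE HOMOGENEOUS — the displayed hypothesis `hT` of this seat's
# zero-input rows (`PortZD.nextAction_add_const`, `stepOutT_add_const`, `…PortZDHistoryFluctuation` §1) DISCHARGED at the kernel transform `transportOfRecord`
# (unconditionally), at the canonical-version transport `TcanOfRecord = TβOfRecord₁₃` (unconditionally), and the kernel transform's WINDOW faces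
# (locality ∕ monotonicity through any co-null window of the averaging kernel)

[Balaban1987RG1] = [I] (CMP 109, 1987): (0.13) p. 254 («(Tρ)(V) = ∫ dU t(V,U) ρ(U)»), (0.19) p. 255–256, (2.12)–(2.14) p. 268; [Balaban1988Convergent] = [III] (CMP 119, 1988):
(3.1) p. 264.

Seat `ymgap-nodeO-port-PTZ-1` g3 (prover, HELPER MODE; `--supports stmt-QuantumFields-27930 --as helper`).  Every row is over the χ-GENERIC layer (no token of the χ-cone of
record: `transportOfRecord`, `TcanOfRecord`, `TβOfRecord₁₃` are the record's TRANSPORT names, not selections); CRIT-1 Q-5 (β).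
WHAT IS PROVED (0 sorry; no `def` ∕ `instance` ∕ `notation`):
* §1 generic (second-countable `α`, open-positive `μ`): `regSet_const_mul_subset` ∕ `regSet_const_mul` — the maximal regular open set of `a·f` is that of `f` (`a ≠ 0`);
  ★ `canonVersion_const_mul` — `canonVersion μ (a·f) = a · canonVersion μ f` AT EVERY POINT, for EVERY `a` (on `regSet` both sides are continuous versions of `a·f` —
  determinacy `Node00.canonVersion_eqOn_of_continuousOn`; off it both are the functions verbatim; `a = 0`: the zero function is its own everywhere-continuous version).
* §2 at the record's transports: ★ `transportOfRecord_const_mul_fun` — (function-level twin of N11's pointwise `transportOfRecord_const_mul`) the kernel transform `(Tρ)(V) = h(V)·∫ρ d(condLaw V)` is degree-one homogeneous (`integral_const_mul`, no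
  integrability needed); ★★ `TcanOfRecord_const_mul` ∕ `TβOfRecord₁₃_const_mul` — so is the canonical-version transport of record, hence the β-layer transport of Stage 13,
  UNCONDITIONALLY — i.e. the `hT` of `PortZD.nextAction_add_const` ∕ `stepOutT_add_const` ∕ `…HistoryFluctuation` holds at the record's own transport (`hT_TcanOfRecord`, the
  literal hypothesis shape); `stepOutT_add_const_Tcan` — a constant input passes through THE RECORD's step with the opposite sign and no response.
* §3 the kernel transform's window faces: `transportOfRecord_congr_window` — `T ρ V = T ρ′ V` when `ρ = ρ′` on a window `S` with `(avgKernel V) Sᶜ = 0` (e.g. the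
  averaging fibre `{U | Ū = V}` for `(dU.map avg)`-a.e. `V`, `T4AveragingDisintegration.avgKernel_fibre_ae`); `transportOfRecord_mono_window` — `T ρ V ≤ T ρ′ V` when `ρ ≤ ρ′` on
  such a window and both are `avgKernel V`-integrable (the honest edition of `…HistoryFluctuation` §3's `hmono`: monotone on INTEGRABLE densities);
  `transportOfRecord_fibre_window_ae` — the fibre is such a window for a.e. coarse field.
* §4 this seat's (2.12)–(2.14) rows AT `TcanOfRecord` with `hT` DISCHARGED: ★★ `stepOutT_add_sub_eq_log_fluct_Tcan`, ★★ `dChannel_eq_log_fluct_Tcan`,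
  ★★ `dChannel_eq_log_fluct_Tcan_of_gaugeInvariant` (the positivity of the step integrals and `GaugeInvariant A_k` stay displayed).
LOCATED (said, not claimed): `TcanOfRecord` inherits the window faces only ON `regSetOfRecord` through continuity (node00 (F1)–(F3)); nothing of that is asserted here.

HONEST FRAMING.  Measure-theoretic bookkeeping (`integral_const_mul`, `integral_congr_ae`, `integral_mono_ae`, determinacy of continuous versions on open sets); NOTHING of
Bałaban's estimates asserted, ported or discharged; no named fact introduced; 26648 ∕ 27930⁸ SIGNED·OPEN (content-gated), 27931 OPEN (RC-3), 27932 CLOSED; K0⁷ ∕ K-Ax OPEN; counts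
unmoved; finite 𝕋⁴ at fixed ε — NOT continuum ∕ OS ∕ Clay; the Yang–Mills mass gap is NOT proved by any of this.  No `sorry`, no `instance`, no `notation`, no `def`.
-/

noncomputable section

open MeasureTheory Set

namespace Summit.QuantumFields.YangMills.Theorems.PortZD

open Literature.MathematicalPhysics.QuantumFieldTheory.Balaban1983to89
open Literature.MathematicalPhysics.QuantumFieldTheory.Balaban1983to89.Node00
open Literature.MathematicalPhysics.QuantumFieldTheory.Balaban1983to89.Node00.ZeroInput
open T4Continuum (T4Family)

/-! ## §1. The canonical version is degree-one homogeneous (generic) -/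

section Generic

open _root_.Topology

variable {α : Type*} [TopologicalSpace α] [MeasurableSpace α] {μ : Measure α} {f : α → ℝ}

/-- A continuous version of `f` on `U` scales to one of `a·f` on `U`. [cite: Balaban1987RG1, (0.13) p.254 (bookkeeping)] -/
theorem hasContVersionOn_const_mul {U : Set α} (h : HasContVersionOn μ f U) (a : ℝ) : HasContVersionOn μ (fun x => a * f x) U := by
  obtain ⟨g, hg, hae⟩ := h
  refine ⟨fun x => a * g x, continuousOn_const.mul hg, ?_⟩
  filter_upwards [hae] with x hx
  simp only [hx]

/-- `regSet μ (a·f) ⊆ regSet μ f` for `a ≠ 0` (scale a local continuous version of `a·f` by `a⁻¹`). [cite: Balaban1987RG1, (0.13) p.254 (bookkeeping)] -/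
theorem regSet_const_mul_subset {a : ℝ} (ha : a ≠ 0) : regSet μ (fun x => a * f x) ⊆ regSet μ f := by
  intro x hx
  obtain ⟨U, hU, hxU, hV⟩ := mem_regSet_iff.1 hx
  refine mem_regSet_iff.2 ⟨U, hU, hxU, ?_⟩
  have h := hasContVersionOn_const_mul hV a⁻¹
  have hfun : (fun x => a⁻¹ * (a * f x)) = f := by
    funext y; rw [← mul_assoc, inv_mul_cancel₀ ha, one_mul]
  rwa [hfun] at h

/-- `regSet μ (a·f) = regSet μ f` for `a ≠ 0`. [cite: Balaban1987RG1, (0.13) p.254 (bookkeeping)] -/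
theorem regSet_const_mul {a : ℝ} (ha : a ≠ 0) : regSet μ (fun x => a * f x) = regSet μ f := by
  refine Subset.antisymm (regSet_const_mul_subset ha) ?_
  have h := regSet_const_mul_subset (μ := μ) (f := fun x => a * f x) (inv_ne_zero ha)
  have hfun : (fun x => a⁻¹ * (a * f x)) = f := by
    funext y; rw [← mul_assoc, inv_mul_cancel₀ ha, one_mul]
  rwa [hfun] at h

/-- ★ **THE CANONICAL VERSION IS DEGREE-ONE HOMOGENEOUS, AT EVERY POINT**: `canonVersion μ (a·f) = a · canonVersion μ f` (second-countable `α`, open-positive `μ`; every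
`a`).  On `regSet μ f` both sides are continuous versions of `a·f` on an open set (determinacy); off it both read the functions verbatim; for `a = 0` the zero function
is its own everywhere-continuous version. [cite: Balaban1987RG1, (0.13) p.254 and (0.19) p.255 (bookkeeping)] -/
theorem canonVersion_const_mul [SecondCountableTopology α] [OpensMeasurableSpace α] [μ.IsOpenPosMeasure] (a : ℝ) :
    canonVersion μ (fun x => a * f x) = fun x => a * canonVersion μ f x := by
  funext x
  by_cases ha : a = 0
  · subst ha
    simp only [zero_mul]
    have h : EqOn (canonVersion μ (fun _ : α => (0 : ℝ))) (fun _ => (0 : ℝ)) univ :=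
      canonVersion_eqOn_of_continuousOn isOpen_univ continuousOn_const (Filter.EventuallyEq.refl _ _)
    exact h (mem_univ x)
  by_cases hx : x ∈ regSet μ f
  · -- on the maximal regular set: `a · canonVersion μ f` is a continuous version of `a·f` there
    have hcont : ContinuousOn (fun y => a * canonVersion μ f y) (regSet μ f) := continuousOn_const.mul continuousOn_canonVersion
    have hae : (fun y => a * canonVersion μ f y) =ᵐ[μ.restrict (regSet μ f)] fun y => a * f y := by
      filter_upwards [ae_restrict_of_ae (canonVersion_ae_eq (μ := μ) (f := f))] with y hy
      simp only [hy]
    exact canonVersion_eqOn_of_continuousOn isOpen_regSet hcont hae hx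
  · -- off it: both sides are the functions verbatim
    have hx' : x ∉ regSet μ (fun y => a * f y) := fun h => hx (regSet_const_mul_subset ha h)
    rw [canonVersion_eq_of_not_mem hx', canonVersion_eq_of_not_mem hx]

end Generic

/-! ## §2. At the record: the kernel transform and the canonical-version transport are degree-one homogeneous -/

variable (F : T4Family) (N : ℕ) [NeZero N]

/-- ★ **THE KERNEL TRANSFORM OF RECORD IS DEGREE-ONE HOMOGENEOUS** — `(T(a·ρ))(V) = h(V) · ∫ a·ρ d(condLaw V) = a · (Tρ)(V)`, for every density and every `a`
(`integral_const_mul`; no integrability needed). [cite: Balaban1987RG1, (0.13) p.254; Balaban1988Convergent, (3.1) p.264 (bookkeeping)] -/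
theorem transportOfRecord_const_mul_fun (K k : ℕ) (a : ℝ) (ρ : Density (F.P K) k (SU N)) :
    transportOfRecord F N K k (fun U => a * ρ U) = fun V => a * transportOfRecord F N K k ρ V := by
  funext V
  show (T4AveragingDisintegration.avgDensity (avOfRecord F N K k).avg V : ℝ) *
        ∫ U, a * ρ U ∂(T4AveragingDisintegration.avgKernel (avOfRecord F N K k).avg V) =
      a * ((T4AveragingDisintegration.avgDensity (avOfRecord F N K k).avg V : ℝ) *
        ∫ U, ρ U ∂(T4AveragingDisintegration.avgKernel (avOfRecord F N K k).avg V))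
  rw [integral_const_mul]
  ring

/-- ★★ **THE CANONICAL-VERSION TRANSPORT OF RECORD IS DEGREE-ONE HOMOGENEOUS, UNCONDITIONALLY** (`§1` at the kernel transform of `ρ`).
[cite: Balaban1987RG1, (0.13) p.254, (0.19) p.255 (bookkeeping)] -/
theorem TcanOfRecord_const_mul (K k : ℕ) (a : ℝ) (ρ : Density (F.P K) k (SU N)) :
    TcanOfRecord F N K k (fun U => a * ρ U) = fun V => a * TcanOfRecord F N K k ρ V := by
  haveI := isOpenPosMeasure_piHaar_SUN N (F.P K) (k + 1)
  rw [TcanOfRecord_apply, TcanOfRecord_apply, transportOfRecord_const_mul_fun]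
  exact canonVersion_const_mul a

/-- The same for the β-layer transport token of Stage 13 (`TβOfRecord₁₃ = TcanOfRecord`, `rfl`). [cite: Balaban1987RG1, (0.13) p.254, (0.19) p.255 (bookkeeping)] -/
theorem TβOfRecord₁₃_const_mul (K k : ℕ) (a : ℝ) (ρ : Density (F.P K) k (SU N)) :
    TβOfRecord₁₃ F N K k (fun U => a * ρ U) = fun V => a * TβOfRecord₁₃ F N K k ρ V :=
  TcanOfRecord_const_mul F N K k a ρ

/-- **The displayed hypothesis `hT` of this seat's zero-input rows, in its literal shape, AT THE RECORD's TRANSPORT.**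
[cite: Balaban1987RG1, (0.19) p.255–256 (bookkeeping)] -/
theorem hT_TcanOfRecord (K k : ℕ) :
    ∀ (a : ℝ) (ρ : Density (F.P K) k (SU N)), TcanOfRecord F N K k (fun U => a * ρ U) = fun V => a * TcanOfRecord F N K k ρ V :=
  fun a ρ => TcanOfRecord_const_mul F N K k a ρ

/-- The same for the kernel transform read as a transport family `fun K k => transportOfRecord F N K k`. [cite: Balaban1987RG1, (0.13) p.254 (bookkeeping)] -/
theorem hT_transportOfRecord (K k : ℕ) :
    ∀ (a : ℝ) (ρ : Density (F.P K) k (SU N)),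
      (fun K k => transportOfRecord F N K k) K k (fun U => a * ρ U) = fun V => a * (fun K k => transportOfRecord F N K k) K k ρ V :=
  fun a ρ => transportOfRecord_const_mul_fun F N K k a ρ

/-- **A CONSTANT INPUT PASSES THROUGH THE RECORD's STEP WITH THE OPPOSITE SIGN AND NO RESPONSE**: `R_k(A + c)(W) = R_k(A)(W) − c` over `TcanOfRecord` (every χ, ε, g) —
this seat's gen-0 `stepOutT_add_const` with its `hT` discharged. [cite: Balaban1987RG1, (0.19) p.255–256, (1.6) p.261 (bookkeeping)] -/
theorem stepOutT_add_const_Tcan (χ : (K : ℕ) → (ℕ → ℝ) → (k : ℕ) → Density (F.P K) k (SU N)) (ε : ℝ) (K : ℕ) (g : ℕ → ℝ) (k : ℕ)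
    (A : Density (F.P K) k (SU N)) (c : ℝ) (W : GaugeField (F.P K) (k + 1) (SU N)) :
    stepOutT F N (TcanOfRecord F N) χ ε K g k (fun U => A U + c) W = stepOutT F N (TcanOfRecord F N) χ ε K g k A W - c :=
  stepOutT_add_const F N (TcanOfRecord F N) χ ε K g k (hT_TcanOfRecord F N K k) A c W

/-- The 𝐓-level form: `𝐓_k(A + c) = 𝐓_k(A)` over `TcanOfRecord` (gen-0 `nextAction_add_const`, `hT` discharged). [cite: Balaban1987RG1, (0.19) p.255–256 (bookkeeping)] -/
theorem nextAction_add_const_Tcan {K k : ℕ} (χ GF : Density (F.P K) k (SU N)) (gk : ℝ) (A : Density (F.P K) k (SU N)) (c : ℝ) :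
    B12Eq019ActionBody.nextAction (TcanOfRecord F N K k) χ GF gk (fun U => A U + c) =
      B12Eq019ActionBody.nextAction (TcanOfRecord F N K k) χ GF gk A :=
  nextAction_add_const (hT_TcanOfRecord F N K k) χ GF gk A c

/-! ## §3. The kernel transform's window faces: locality and monotonicity through any co-null window of the averaging kernel -/

/-- **LOCALITY THROUGH A CO-NULL WINDOW**: if the averaging kernel at `V` gives no mass outside `S` and `ρ = ρ′` on `S`, the kernel transforms agree at `V`.
[cite: Balaban1987RG1, (0.13) p.254 (bookkeeping: the δ-function reads the density on the fibre only)] -/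
theorem transportOfRecord_congr_window {K k : ℕ} {S : Set (GaugeField (F.P K) k (SU N))} {V : GaugeField (F.P K) (k + 1) (SU N)}
    (hS : T4AveragingDisintegration.avgKernel (avOfRecord F N K k).avg V Sᶜ = 0) {ρ ρ' : Density (F.P K) k (SU N)} (h : ∀ U ∈ S, ρ U = ρ' U) :
    transportOfRecord F N K k ρ V = transportOfRecord F N K k ρ' V := by
  show (T4AveragingDisintegration.avgDensity (avOfRecord F N K k).avg V : ℝ) * ∫ U, ρ U ∂(T4AveragingDisintegration.avgKernel (avOfRecord F N K k).avg V) =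
    (T4AveragingDisintegration.avgDensity (avOfRecord F N K k).avg V : ℝ) * ∫ U, ρ' U ∂(T4AveragingDisintegration.avgKernel (avOfRecord F N K k).avg V)
  congr 1
  refine integral_congr_ae ?_
  filter_upwards [measure_eq_zero_iff_ae_notMem.1 hS] with U hU
  exact h U (Set.notMem_compl_iff.1 hU)

/-- **MONOTONICITY THROUGH A CO-NULL WINDOW, ON INTEGRABLE DENSITIES**: `ρ ≤ ρ′` on `S`, `(avgKernel V) Sᶜ = 0`, both `avgKernel V`-integrable ⇒ `T ρ V ≤ T ρ′ V`
(the marginal density is non-negative). [cite: Balaban1987RG1, (0.13) p.254 (bookkeeping)] -/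
theorem transportOfRecord_mono_window {K k : ℕ} {S : Set (GaugeField (F.P K) k (SU N))} {V : GaugeField (F.P K) (k + 1) (SU N)}
    (hS : T4AveragingDisintegration.avgKernel (avOfRecord F N K k).avg V Sᶜ = 0) {ρ ρ' : Density (F.P K) k (SU N)}
    (hρ : Integrable ρ (T4AveragingDisintegration.avgKernel (avOfRecord F N K k).avg V))
    (hρ' : Integrable ρ' (T4AveragingDisintegration.avgKernel (avOfRecord F N K k).avg V)) (h : ∀ U ∈ S, ρ U ≤ ρ' U) :
    transportOfRecord F N K k ρ V ≤ transportOfRecord F N K k ρ' V := by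
  show (T4AveragingDisintegration.avgDensity (avOfRecord F N K k).avg V : ℝ) * ∫ U, ρ U ∂(T4AveragingDisintegration.avgKernel (avOfRecord F N K k).avg V) ≤
    (T4AveragingDisintegration.avgDensity (avOfRecord F N K k).avg V : ℝ) * ∫ U, ρ' U ∂(T4AveragingDisintegration.avgKernel (avOfRecord F N K k).avg V)
  refine mul_le_mul_of_nonneg_left (integral_mono_ae hρ hρ' ?_) (NNReal.coe_nonneg _)
  filter_upwards [measure_eq_zero_iff_ae_notMem.1 hS] with U hU
  exact h U (Set.notMem_compl_iff.1 hU)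

/-- **THE AVERAGING FIBRE IS A CO-NULL WINDOW FOR ALMOST EVERY COARSE FIELD** (w.r.t. the image of `dU`): the kernel form of `δ(ŪV⁻¹)`
(`T4AveragingDisintegration.avgKernel_fibre_ae`). [cite: Balaban1987RG1, (0.13) p.254; Balaban1985Averaging, (10) p.19 (bookkeeping)] -/
theorem transportOfRecord_fibre_window_ae (K k : ℕ) :
    ∀ᵐ V ∂((fieldMeasure (F.P K) k (SU N)).map (avOfRecord F N K k).avg),
      T4AveragingDisintegration.avgKernel (avOfRecord F N K k).avg V {U | (avOfRecord F N K k).avg U = V}ᶜ = 0 := by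
  filter_upwards [T4AveragingDisintegration.avgKernel_fibre_ae (avOfRecord_measurable F N K k)] with V hV
  exact (prob_compl_eq_zero_iff (measurableSet_eq_fun (avOfRecord_measurable F N K k) measurable_const)).2 hV

/-! ## §4. This seat's (2.12)–(2.14) rows AT THE CANONICAL-VERSION TRANSPORT OF RECORD — the `hT` of `…PortZDHistoryFluctuation` discharged -/

open B12Eq019ActionBody (integrand normConst) in
/-- ★★ **THE HISTORY RESPONSE OVER `TcanOfRecord` IS THE LOG-MOMENT OF THE HISTORY FLUCTUATION** (`PortZD.stepOutT_add_sub_eq_log_fluct` with `hT := hT_TcanOfRecord`; the two steps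
defined at `W` and at `1` displayed; every χ, ε, g, A, E). [cite: Balaban1987RG1, (1.6) p.261, (2.12)–(2.14) p.268] -/
theorem stepOutT_add_sub_eq_log_fluct_Tcan (χ : (K : ℕ) → (ℕ → ℝ) → (k : ℕ) → Density (F.P K) k (SU N)) (ε : ℝ) (K : ℕ) (g : ℕ → ℝ) (k : ℕ)
    (A E : Density (F.P K) k (SU N)) (W : GaugeField (F.P K) (k + 1) (SU N))
    (hAW : 0 < TcanOfRecord F N K k (integrand (χ K g k) (gfOfRecord F N K k) (g k) A) W)
    (hA1 : 0 < TcanOfRecord F N K k (integrand (χ K g k) (gfOfRecord F N K k) (g k) A) 1)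
    (hEW : 0 < TcanOfRecord F N K k (integrand (χ K g k) (gfOfRecord F N K k) (g k) (A + E)) W)
    (hE1 : 0 < TcanOfRecord F N K k (integrand (χ K g k) (gfOfRecord F N K k) (g k) (A + E)) 1) :
    stepOutT F N (TcanOfRecord F N) χ ε K g k (A + E) W - stepOutT F N (TcanOfRecord F N) χ ε K g k A W =
      Real.log (TcanOfRecord F N K k (integrand (χ K g k) (gfOfRecord F N K k) (g k)
          (A + fun U => E U - E (Averaging.iter (avOfRecord F N K) k (Uk F N K (k + 1) ε W)))) W /
        TcanOfRecord F N K k (integrand (χ K g k) (gfOfRecord F N K k) (g k) A) W) -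
      Real.log (TcanOfRecord F N K k (integrand (χ K g k) (gfOfRecord F N K k) (g k)
          (A + fun U => E U - E (Averaging.iter (avOfRecord F N K) k (Uk F N K (k + 1) ε 1)))) 1 /
        TcanOfRecord F N K k (integrand (χ K g k) (gfOfRecord F N K k) (g k) A) 1) -
      E (Averaging.iter (avOfRecord F N K) k (Uk F N K (k + 1) ε 1)) :=
  stepOutT_add_sub_eq_log_fluct F N (TcanOfRecord F N) χ ε K g k (hT_TcanOfRecord F N K k) A E W hAW hA1 hEW hE1

open B12Eq019ActionBody (integrand normConst) in
/-- ★★ **`𝓓_{k+1}` OVER `TcanOfRecord` IS THE LOG-MOMENT OF THE HISTORY FLUCTUATION UNDER THE ZERO-INPUT STEP** (`PortZD.dChannel_eq_log_fluct`, `hT` discharged; the zero-input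
and the full step defined at `W` and at `1` displayed). [cite: Balaban1987RG1, (0.22) p.256, (1.6) p.261, (2.12)–(2.14) p.268] -/
theorem dChannel_eq_log_fluct_Tcan (χ : (K : ℕ) → (ℕ → ℝ) → (k : ℕ) → Density (F.P K) k (SU N)) (ε : ℝ) (K : ℕ) (g : ℕ → ℝ) (k : ℕ)
    (W : GaugeField (F.P K) (k + 1) (SU N))
    (h0W : 0 < TcanOfRecord F N K k (integrand (χ K g k) (gfOfRecord F N K k) (g k) (mainTermT F N ε K g k)) W)
    (h01 : 0 < TcanOfRecord F N K k (integrand (χ K g k) (gfOfRecord F N K k) (g k) (mainTermT F N ε K g k)) 1)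
    (hW : 0 < TcanOfRecord F N K k (integrand (χ K g k) (gfOfRecord F N K k) (g k) (effActionHT F N (TcanOfRecord F N) χ K g k)) W)
    (h1 : 0 < TcanOfRecord F N K k (integrand (χ K g k) (gfOfRecord F N K k) (g k) (effActionHT F N (TcanOfRecord F N) χ K g k)) 1) :
    mergedTermT F N (TcanOfRecord F N) χ ε K g k W - zeroInputMergedTermT F N (TcanOfRecord F N) χ ε K g k W =
      Real.log (TcanOfRecord F N K k (integrand (χ K g k) (gfOfRecord F N K k) (g k)
          (mainTermT F N ε K g k + fun U => EkT F N (TcanOfRecord F N) χ ε K g k U -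
            EkT F N (TcanOfRecord F N) χ ε K g k (Averaging.iter (avOfRecord F N K) k (Uk F N K (k + 1) ε W)))) W /
        TcanOfRecord F N K k (integrand (χ K g k) (gfOfRecord F N K k) (g k) (mainTermT F N ε K g k)) W) -
      Real.log (TcanOfRecord F N K k (integrand (χ K g k) (gfOfRecord F N K k) (g k)
          (mainTermT F N ε K g k + fun U => EkT F N (TcanOfRecord F N) χ ε K g k U -
            EkT F N (TcanOfRecord F N) χ ε K g k (Averaging.iter (avOfRecord F N K) k (Uk F N K (k + 1) ε 1)))) 1 /
        TcanOfRecord F N K k (integrand (χ K g k) (gfOfRecord F N K k) (g k) (mainTermT F N ε K g k)) 1) -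
      EkT F N (TcanOfRecord F N) χ ε K g k (Averaging.iter (avOfRecord F N K) k (Uk F N K (k + 1) ε 1)) :=
  dChannel_eq_log_fluct F N (TcanOfRecord F N) χ ε K g k (hT_TcanOfRecord F N K k) W h0W h01 hW h1

open B12Eq019ActionBody (integrand normConst) in
open GaugeField (GaugeInvariant) in
/-- ★★ **`𝓓_{k+1}(W) = log⟨e^{𝐄_k − 𝐄_k(bg_W)}⟩⁰_W − log[𝐍_k(A_k) ∕ 𝐍_k(A⁰_k)]` OVER `TcanOfRecord`** (`PortZD.dChannel_eq_log_fluct_of_gaugeInvariant`, `hT` discharged; `GaugeInvariant A_k`,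
`ε > 0`, `k + 1 ≤ m + K` and the positivity of the four step integrals displayed). [cite: Balaban1987RG1, (0.19) p.255–256, (1.6) p.261, (2.12)–(2.14) p.268, (2.16) p.269] -/
theorem dChannel_eq_log_fluct_Tcan_of_gaugeInvariant (χ : (K : ℕ) → (ℕ → ℝ) → (k : ℕ) → Density (F.P K) k (SU N)) {ε : ℝ} (hε : 0 < ε) {K : ℕ}
    (g : ℕ → ℝ) {k : ℕ} (hk : k + 1 ≤ (F.P K).m + (F.P K).K) (hinv : GaugeInvariant (effActionHT F N (TcanOfRecord F N) χ K g k))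
    (W : GaugeField (F.P K) (k + 1) (SU N))
    (h0W : 0 < TcanOfRecord F N K k (integrand (χ K g k) (gfOfRecord F N K k) (g k) (mainTermT F N ε K g k)) W)
    (h01 : 0 < TcanOfRecord F N K k (integrand (χ K g k) (gfOfRecord F N K k) (g k) (mainTermT F N ε K g k)) 1)
    (hW : 0 < TcanOfRecord F N K k (integrand (χ K g k) (gfOfRecord F N K k) (g k) (effActionHT F N (TcanOfRecord F N) χ K g k)) W)
    (h1 : 0 < TcanOfRecord F N K k (integrand (χ K g k) (gfOfRecord F N K k) (g k) (effActionHT F N (TcanOfRecord F N) χ K g k)) 1) :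
    mergedTermT F N (TcanOfRecord F N) χ ε K g k W - zeroInputMergedTermT F N (TcanOfRecord F N) χ ε K g k W =
      Real.log (TcanOfRecord F N K k (integrand (χ K g k) (gfOfRecord F N K k) (g k)
          (mainTermT F N ε K g k + fun U => EkT F N (TcanOfRecord F N) χ ε K g k U -
            EkT F N (TcanOfRecord F N) χ ε K g k (Averaging.iter (avOfRecord F N K) k (Uk F N K (k + 1) ε W)))) W /
        TcanOfRecord F N K k (integrand (χ K g k) (gfOfRecord F N K k) (g k) (mainTermT F N ε K g k)) W) -
      Real.log (normConst (TcanOfRecord F N K k) (χ K g k) (gfOfRecord F N K k) (g k) (effActionHT F N (TcanOfRecord F N) χ K g k) /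
        normConst (TcanOfRecord F N K k) (χ K g k) (gfOfRecord F N K k) (g k) (mainTermT F N ε K g k)) :=
  dChannel_eq_log_fluct_of_gaugeInvariant F N (TcanOfRecord F N) χ hε g hk (hT_TcanOfRecord F N K k) hinv W h0W h01 hW h1

end Summit.QuantumFields.YangMills.Theorems.PortZD

end
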